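import Summits.ResolutionOfSingularities.ResolutionOfSingularities.Theorems.MarkedTransferCampaignW46MohWindowShadeDigits
import HarnessLib

/-!
# [OURS · L1 W4.6] Rung (iii) "Moh window", surfaces — SHARPNESS: every polynomial `p`-fold branch carries an infinite
  in-window walk (proofs only)

Cell `res-hironaka`, rung L, slot W4.6, seat `res-L1-s46-pv-6` (gen 3).  The termination theorem (`…Termination`,
`…FormalBranch`) says an infinite in-window walk of equimultiple point blow-ups of `x^p + F(y_j, y_i)` (Hauser–Wagner frame)
meets a formal `p`-fold curve.  Conversely — beyond gen 2's two examples (`…Cycle`, `…FixedPoint`) — EVERY state of the form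
`F = y_j^R · (y_i − ψ(y_j))^p`, `1 ≤ R ≤ p − 1`, `ψ(y_j) = Σ_{k<D} t_k y_j^{k+1}` a polynomial branch, `r = R·e_j`, starts an
INFINITE walk satisfying every hypothesis of `CampaignW46MohWindowShadeSurfaceTerminates`: blow up, read the chart `y_j` at the
point `t_0` (the first digit), and the new state is `y_j^R · (y_i − ψ'(y_j))^p` with the SHIFTED digits `ψ' = Σ t_{k+1} y_j^{k+1}`
(`step_branchState`); every step is equimultiple (`isEquimultiplePoint_branchState`), every state is cleaned, has `y^r ∣ F`, and
order `R + p` inside the window; after the digits are exhausted the walk continues for ever with horizontal moves on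
`y_j^R · y_i^p`.  So the exclusion in the termination theorem is exactly right: the `p`-fold branches are precisely where
infinite in-window walks live (`exists_infinite_walk_of_branch`).  OURS; NOT a statement of the manuscript
[claim: Hironaka2017, status: under-review], nothing of which is used.  AI review is weaker than expert review.
-/

noncomputable section

set_option linter.dupNamespace false -- mandated namespace of this single-conjunct summit

open MvPolynomial Finset

namespace Summit.ResolutionOfSingularities.ResolutionOfSingularities.Theorems.CampaignW46.MohWindowShadeBranchWalk

open Literature.AlgebraicGeometry.Resolution
open Literature.AlgebraicGeometry.Resolution.PointBlowup
open Literature.AlgebraicGeometry.Resolution.Hauser2010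
open Literature.Barriers.ResolutionOfSingularities (ordZero_le_of_coeff_ne_zero le_ordZero_of_forall)
open MohWindowShadeCleaning (eq_single_add_single degree_eq_add pointTransform_mul_X_pow)
open MohWindowShadeDigits (aeval_digits coeff_zero_digits coeff_single_digits)

variable {σ : Type*} {K : Type*} [Field K] [Fintype σ] [DecidableEq σ] [DecidableEq K]
variable (p : ℕ) [hp : Fact p.Prime] [CharP K p]

section TwoLetters

variable {j i : σ}

omit [Fintype σ] [DecidableEq σ] [DecidableEq K] in
/-- The `p`-th power of the digit polynomial: `(Σ_{k<D} t_k y_j^{k+1})^p = Σ_{k<D} t_k^p y_j^{p(k+1)}` (Frobenius).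
[folklore] -/
theorem digits_pow_char (t : ℕ → K) (D : ℕ) :
    (∑ k ∈ Finset.range D, C (t k) * X j ^ (k + 1) : MvPolynomial σ K) ^ p =
      ∑ k ∈ Finset.range D, C (t k ^ p) * X j ^ (p * (k + 1)) := by
  rw [sum_pow_char]
  refine Finset.sum_congr rfl fun k _ => ?_
  rw [mul_pow, ← map_pow, ← pow_mul, mul_comm (k + 1) p]

omit [Fintype σ] [DecidableEq σ] [DecidableEq K] in
/-- The branch polynomial as a sum of monomials:
`y_j^R (y_i − ψ)^p = y^{R e_j + p e_i} − Σ_{k<D} t_k^p · y_j^{R + p(k+1)}`. [folklore] -/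
theorem branch_eq_sum (R : ℕ) (t : ℕ → K) (D : ℕ) :
    (X j ^ R * (X i - ∑ k ∈ Finset.range D, C (t k) * X j ^ (k + 1)) ^ p : MvPolynomial σ K) =
      monomial (Finsupp.single j R + Finsupp.single i p) 1 -
        ∑ k ∈ Finset.range D, monomial (Finsupp.single j (R + p * (k + 1))) (t k ^ p) := by
  rw [sub_pow_char, digits_pow_char, mul_sub, Finset.mul_sum]
  congr 1
  · rw [X_pow_eq_monomial, X_pow_eq_monomial, monomial_mul, one_mul]
  · refine Finset.sum_congr rfl fun k _ => ?_
    rw [C_mul_X_pow_eq_monomial, X_pow_eq_monomial, monomial_mul, one_mul, ← Finsupp.single_add]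

omit [Fintype σ] [DecidableEq K] in
/-- Coefficients of the branch polynomial. [folklore] -/
theorem coeff_branch {R : ℕ} (t : ℕ → K) (D : ℕ) (e : σ →₀ ℕ) :
    coeff e (X j ^ R * (X i - ∑ k ∈ Finset.range D, C (t k) * X j ^ (k + 1)) ^ p : MvPolynomial σ K) ≠ 0 →
      (e = Finsupp.single j R + Finsupp.single i p ∨ ∃ k < D, e = Finsupp.single j (R + p * (k + 1))) := by
  classical
  intro he
  rw [branch_eq_sum p, coeff_sub, coeff_monomial, coeff_sum] at he
  by_cases h1 : Finsupp.single j R + Finsupp.single i p = e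
  · exact Or.inl h1.symm
  · rw [if_neg h1, zero_sub, neg_ne_zero] at he
    obtain ⟨k, hk, hne⟩ := Finset.exists_ne_zero_of_sum_ne_zero he
    rw [coeff_monomial] at hne
    by_cases h2 : Finsupp.single j (R + p * (k + 1)) = e
    · exact Or.inr ⟨k, Finset.mem_range.mp hk, h2.symm⟩
    · rw [if_neg h2] at hne; exact absurd rfl hne

omit [Fintype σ] [DecidableEq K] in
/-- The monomial `y_j^R y_i^p` occurs in the branch polynomial with coefficient `1`. [folklore] -/
theorem coeff_branch_lead (hij : i ≠ j) (R : ℕ) (t : ℕ → K) (D : ℕ) :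
    coeff (Finsupp.single j R + Finsupp.single i p)
      (X j ^ R * (X i - ∑ k ∈ Finset.range D, C (t k) * X j ^ (k + 1)) ^ p : MvPolynomial σ K) = 1 := by
  classical
  rw [branch_eq_sum p, coeff_sub, coeff_monomial, if_pos rfl, coeff_sum, Finset.sum_eq_zero, sub_zero]
  intro k _
  rw [coeff_monomial, if_neg]
  intro h
  have := DFunLike.congr_fun h i
  rw [Finsupp.single_eq_of_ne hij, Finsupp.add_apply, Finsupp.single_eq_of_ne hij,
    Finsupp.single_eq_same, zero_add] at this
  exact hp.out.ne_zero this.symm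

omit [Fintype σ] in
/-- **[OURS · L1 W4.6] The branch state is a legitimate in-window state.**  For `1 ≤ R`, `p ∤ R`: the residual polynomial
`F = y_j^R (y_i − ψ)^p` is cleaned, divisible by `y^r` for `r = R·e_j`, and of order exactly `R + p`.  NOT a statement of
the manuscript. [folklore] -/
theorem branchState_invariants (hij : i ≠ j) {R : ℕ} (hR : ¬ p ∣ R) (t : ℕ → K) (D : ℕ) :
    deletePthPowers p (X j ^ R * (X i - ∑ k ∈ Finset.range D, C (t k) * X j ^ (k + 1)) ^ p : MvPolynomial σ K)
        = X j ^ R * (X i - ∑ k ∈ Finset.range D, C (t k) * X j ^ (k + 1)) ^ p ∧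
      (∀ d ∈ (X j ^ R * (X i - ∑ k ∈ Finset.range D, C (t k) * X j ^ (k + 1)) ^ p : MvPolynomial σ K).support,
        Finsupp.single j R ≤ d) ∧
      ordZero (X j ^ R * (X i - ∑ k ∈ Finset.range D, C (t k) * X j ^ (k + 1)) ^ p : MvPolynomial σ K)
        = (R + p : ℕ) := by
  classical
  have hcases := coeff_branch p (j := j) (i := i) (R := R) t D
  refine ⟨?_, ?_, ?_⟩
  · refine MohWindowShadeCleaning.deletePthPowers_eq_self_of_forall p fun d hd hP => ?_
    rw [isPthPowerExponent_iff] at hP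
    have hj := hP j
    rcases hcases d (MvPolynomial.mem_support_iff.mp hd) with rfl | ⟨k, -, rfl⟩
    · rw [Finsupp.add_apply, Finsupp.single_eq_same, Finsupp.single_eq_of_ne hij.symm, add_zero] at hj
      exact hR hj
    · rw [Finsupp.single_eq_same] at hj
      exact hR ((Nat.dvd_add_left (Dvd.intro _ rfl)).mp hj)
  · intro d hd
    rcases hcases d (MvPolynomial.mem_support_iff.mp hd) with rfl | ⟨k, -, rfl⟩
    · exact le_add_right le_rfl
    · exact Finsupp.single_le_iff.mpr (by rw [Finsupp.single_eq_same]; omega)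
  · rw [ordZero_eq_nat_iff]
    refine ⟨⟨Finsupp.single j R + Finsupp.single i p, ?_, ?_⟩, fun d hd => ?_⟩
    · rw [coeff_branch_lead p hij]; exact one_ne_zero
    · rw [map_add, Finsupp.degree_single, Finsupp.degree_single]
    · by_contra hne
      rcases hcases d hne with rfl | ⟨k, -, rfl⟩
      · rw [map_add, Finsupp.degree_single, Finsupp.degree_single] at hd; omega
      · rw [Finsupp.degree_single] at hd
        have : p ≤ p * (k + 1) := Nat.le_mul_of_pos_right p (Nat.succ_pos k)
        omega

/-- **[OURS · L1 W4.6] THE STEP ALONG THE BRANCH READS ONE DIGIT.**  If the digit sequence vanishes from `D` on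
(`t_D = 0` suffices here), then at the point `t_0` of the chart `y_j` the translated chart transform of
`y_j^R (y_i − Σ_{k<D} t_k y_j^{k+1})^p` is `y_j^R (y_i − Σ_{k<D} t_{k+1} y_j^{k+1})^p` — the same shape with SHIFTED digits;
nothing is cleaned.  NOT a statement of the manuscript. [folklore] -/
theorem pointTransform_branchState (hij : i ≠ j) (htwo : ∀ l, l = j ∨ l = i) {R : ℕ} (hR : ¬ p ∣ R) (t : ℕ → K)
    {D : ℕ} (htD : t D = 0) (b : σ → K) (hbj : b j = 0) (hbi : b i = t 0) :
    pointTransform p j b (State.mk (X j ^ R * (X i - ∑ k ∈ Finset.range D, C (t k) * X j ^ (k + 1)) ^ p)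
        (Finsupp.single j R)) =
      X j ^ R * (X i - ∑ k ∈ Finset.range D, C (t (k + 1)) * X j ^ (k + 1)) ^ p := by
  classical
  obtain ⟨-, -, hord⟩ := branchState_invariants p hij hR t D
  have hdeg : ∀ d ∈ (X j ^ R * (X i - ∑ k ∈ Finset.range D, C (t k) * X j ^ (k + 1)) ^ p :
      MvPolynomial σ K).support, p ≤ d.degree := by
    intro d hd
    have := le_degree_of_ordZero_eq (State.mk _ (Finsupp.single j R)) hord d hd
    omega
  have h := pointTransform_mul_X_pow p hij htwo b hbj (State.mk _ (Finsupp.single j R)) hdeg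
  -- the substitution on the branch polynomial
  have hsub : aeval (fun l => if l = j then X j else (X l + C (b l)) * X j)
      (X j ^ R * (X i - ∑ k ∈ Finset.range D, C (t k) * X j ^ (k + 1)) ^ p : MvPolynomial σ K)
      = X j ^ R * (X i - ∑ k ∈ Finset.range D, C (t (k + 1)) * X j ^ (k + 1)) ^ p * X j ^ p := by
    rw [map_mul, map_pow, map_pow, aeval_X, if_pos rfl, map_sub, aeval_X, if_neg hij, hbi,
      aeval_digits (j := j) _ (if_pos rfl)]
    have key : ((X i + C (t 0)) * X j - ∑ k ∈ Finset.range D, C (t k) * X j ^ (k + 1) : MvPolynomial σ K)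
        = (X i - ∑ k ∈ Finset.range D, C (t (k + 1)) * X j ^ (k + 1)) * X j := by
      rcases D with _ | D
      · rw [Finset.sum_range_zero, Finset.sum_range_zero, htD, C_0]; ring
      · rw [Finset.sum_range_succ' (fun k => C (t k) * X j ^ (k + 1)), Finset.sum_range_succ, htD, C_0,
          zero_mul, add_zero, zero_add, pow_one, sub_mul, Finset.sum_mul]
        have : ∀ k ∈ Finset.range D, (C (t (k + 1)) * X j ^ (k + 1) * X j : MvPolynomial σ K)
            = C (t (k + 1)) * X j ^ (k + 1 + 1) := fun k _ => by ring
        rw [Finset.sum_congr rfl this]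
        ring
    rw [key, mul_pow]
    ring
  rw [hsub] at h
  exact mul_right_cancel₀ (pow_ne_zero p (X_ne_zero j)) h

/-- **[OURS · L1 W4.6] The step along the branch**: the new state is the branch state of the shifted digits, with the
same multiplicities `r = R·e_j`.  NOT a statement of the manuscript. [folklore] -/
theorem step_branchState (hij : i ≠ j) (htwo : ∀ l, l = j ∨ l = i) {R : ℕ} (hR : ¬ p ∣ R) (t : ℕ → K) {D : ℕ}
    (htD : t D = 0) (b : σ → K) (hbj : b j = 0) (hbi : b i = t 0) :
    step p j b (State.mk (X j ^ R * (X i - ∑ k ∈ Finset.range D, C (t k) * X j ^ (k + 1)) ^ p)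
        (Finsupp.single j R)) =
      State.mk (X j ^ R * (X i - ∑ k ∈ Finset.range D, C (t (k + 1)) * X j ^ (k + 1)) ^ p)
        (Finsupp.single j R) := by
  classical
  obtain ⟨-, -, hord⟩ := branchState_invariants p hij hR t D
  obtain ⟨hclean', -, -⟩ := branchState_invariants p hij hR (fun k => t (k + 1)) D
  show State.mk (deletePthPowers p (pointTransform p j b _)) (newMult p j b _) = _
  rw [pointTransform_branchState p hij htwo hR t htD b hbj hbi, hclean',
    newMult_eq p j b hbj _ hord]
  congr 1
  ext l
  rw [Finsupp.filter_apply, Finsupp.update_apply]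
  rcases htwo l with h | h <;> rw [h]
  · rw [if_pos hbj, if_pos rfl, Finsupp.single_eq_same]; omega
  · rw [Finsupp.single_eq_of_ne hij]
    by_cases hb : b i = 0
    · rw [if_pos hb, if_neg hij]
    · rw [if_neg hb]

/-- **[OURS · L1 W4.6] The point `t_0` is equimultiple** (the new residual polynomial has order `R + p ≥ p`).
NOT a statement of the manuscript. [folklore] -/
theorem isEquimultiplePoint_branchState (hij : i ≠ j) (htwo : ∀ l, l = j ∨ l = i) {R : ℕ} (hR : ¬ p ∣ R)
    (t : ℕ → K) {D : ℕ} (htD : t D = 0) (b : σ → K) (hbj : b j = 0) (hbi : b i = t 0) :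
    IsEquimultiplePoint p j b (State.mk (X j ^ R * (X i - ∑ k ∈ Finset.range D, C (t k) * X j ^ (k + 1)) ^ p)
      (Finsupp.single j R)) := by
  intro d _ hdeg
  rw [pointTransform_branchState p hij htwo hR t htD b hbj hbi]
  obtain ⟨-, -, hord⟩ := branchState_invariants p hij hR (fun k => t (k + 1)) D
  by_contra hne
  have := le_degree_of_ordZero_eq (State.mk _ (Finsupp.single j R)) hord d (MvPolynomial.mem_support_iff.mpr hne)
  omega

/-- **[OURS · L1 W4.6] SHARPNESS OF THE TERMINATION THEOREM: every polynomial `p`-fold branch carries an INFINITE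
in-window walk.**  For every prime `p`, field `K` of characteristic `p`, two letters `j ≠ i`, `1 ≤ R ≤ p − 1`, and every
finitely supported digit sequence `t` (`t_k = 0` for `k ≥ D`), the states
`s_n = (y_j^R · (y_i − Σ_{k<D} t_{n+k} y_j^{k+1})^p, R·e_j)` with the points `b_n = t_n · e_i` of the chart `y_j` form an
infinite walk satisfying EVERY hypothesis of `CampaignW46MohWindowShadeSurfaceTerminates` (Hauser–Wagner frame, cleaned start,
`y^r ∣ F`, every step equimultiple, every state of order `R + p` inside the window) — the walk reads the digits of the
branch and then moves horizontally for ever on `y_j^R y_i^p`.  So infinite in-window walks exist through every polynomial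
`p`-fold branch: the exclusion of the formal `p`-fold-curve case in the termination theorem cannot be weakened.  NOT a
statement of the manuscript. [folklore] -/
theorem exists_infinite_walk_of_branch (hij : i ≠ j) (htwo : ∀ l, l = j ∨ l = i) {R : ℕ} (hR1 : 1 ≤ R)
    (hRp : R < p) (t : ℕ → K) {D : ℕ} (htD : ∀ k, D ≤ k → t k = 0) :
    ∃ (s : ℕ → State σ K) (c : ℕ → σ) (b : ℕ → σ → K),
      s 0 = State.mk (X j ^ R * (X i - ∑ k ∈ Finset.range D, C (t k) * X j ^ (k + 1)) ^ p) (Finsupp.single j R) ∧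
      (∀ n, b n (c n) = 0) ∧ (∀ n, c n = i → ∀ l, b n l = 0) ∧
      (∀ n, s (n + 1) = step p (c n) (b n) (s n)) ∧
      deletePthPowers p (s 0).F = (s 0).F ∧ (∀ d ∈ (s 0).F.support, (s 0).r ≤ d) ∧
      (∀ n, IsEquimultiplePoint p (c n) (b n) (s n)) ∧
      (∀ n, (p : ℕ∞) ≤ ordZero (s n).F ∧ ordZero (s n).F < (2 * p : ℕ)) := by
  classical
  have hR : ¬ p ∣ R := fun h => absurd (Nat.le_of_dvd hR1 h) (not_le.mpr hRp)
  refine ⟨fun n => State.mk (X j ^ R * (X i - ∑ k ∈ Finset.range D, C (t (n + k)) * X j ^ (k + 1)) ^ p)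
      (Finsupp.single j R),
    fun _ => j, fun n l => if l = i then t n else 0, ?_, fun n => ?_, fun n h => absurd h hij.symm, fun n => ?_, ?_,
    ?_, fun n => ?_, fun n => ?_⟩
  · simp only [zero_add]
  · show (if j = i then t n else 0) = 0
    rw [if_neg hij.symm]
  · show State.mk _ _ = step p j _ (State.mk _ _)
    rw [step_branchState p hij htwo hR (fun k => t (n + k)) (D := D) (htD _ (by omega)) _ (if_neg hij.symm)
      (by simp)]
    simp only [add_assoc, add_comm 1]
  · exact (branchState_invariants p hij hR (fun k => t (0 + k)) D).1
  · exact (branchState_invariants p hij hR (fun k => t (0 + k)) D).2.1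
  · exact isEquimultiplePoint_branchState p hij htwo hR (fun k => t (n + k)) (D := D) (htD _ (by omega)) _
      (if_neg hij.symm) (by simp)
  · show ((p : ℕ) : ℕ∞) ≤ ordZero (X j ^ R * (X i - ∑ k ∈ Finset.range D, C (t (n + k)) * X j ^ (k + 1)) ^ p) ∧
      ordZero (X j ^ R * (X i - ∑ k ∈ Finset.range D, C (t (n + k)) * X j ^ (k + 1)) ^ p) < (2 * p : ℕ)
    rw [(branchState_invariants p hij hR (fun k => t (n + k)) D).2.2]
    exact ⟨by exact_mod_cast Nat.le_add_left p R, by exact_mod_cast (by omega : R + p < 2 * p)⟩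

end TwoLetters

end Summit.ResolutionOfSingularities.ResolutionOfSingularities.Theorems.CampaignW46.MohWindowShadeBranchWalk
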